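import Literature.MathematicalPhysics.QuantumLattice.FramePosKernelL1
import Literature.Probability.LatticeModels.TorusFourierFirstMoment
import Literature.Probability.LatticeModels.TorusCentredLift
import HarnessLib

/-!
# `ℓ¹` norm and first moment of the lattice position kernel of a SAMPLED smooth periodic symbol, uniformly in the volume

Cell gate-hubbard-kl, seat hubbard-kl-k3c5-p1 (g8; row (b) «Matsubara / analytic suppliers»).  The generic twin of `Literature/…/FramePosKernelL1` (there: a `TrigPolyC4v` frame) for an ARBITRARY
`(2πℤ)²`-periodic function `F` on momentum space, read through its samples `k⃗ ↦ F(p_{k⃗})` on the `L`-torus and the inverse lattice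
Fourier transform `ȟ_L(z) = torusFourierInv (F ∘ p) z = L⁻² Σ_{k⃗} F(p_{k⃗}) χ_{k⃗}(z)` (the position kernel of a multiplier with symbol `F`).
Cell gate-hubbard-kl: the fixed-frequency resummed symbols `τ = (1 + uK)⁻²`, `E = K/(1 + uK)` of the two-volume read-out
(`…TwoVolumeResummedReadout`, hypotheses `‖τ̌‖₁`, `M₁(τ̌)`), and the scale-`0` covariance / multiplier symbols composed with the band
(p3's (E4)₀ note) are such symbols — smooth, non-polynomial.  Everything is uniform in `L`:

* §1 `torusFourierInv` versus `torusFourier`: `torusFourierInv g x = L⁻ᵈ·(torusFourier g)(−x)`, hence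
  `Σ_x ‖torusFourierInv g x‖ = L⁻² Σ_z ‖ĝ(z)‖` and the same with the weight `|x̃_j|`;
* §2 mean-value bounds for vector-valued `C¹/C²/C³` maps on a real normed space (first, mixed second, mixed third differences from
  `‖DᵏF‖ ≤ S_k`);
* §3 DIFFERENCE form: for `F` periodic with `‖F‖ ≤ S₀` and first / mixed-second differences at step `2π/L` bounded by `D₁, D₂`:
  `Σ_z ‖torusFourierInv (F ∘ p_L) z‖ ≤ 6√(S₀² + L²D₁²/8 + L⁴D₂²/256)` (`sum_norm_torusFourierInv_sampled_le_of_differences`,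
  [tree] `sum_norm_torusFourier_le_of_differences`);
* the DERIVATIVE forms (`C²`: `Σ_z ‖…‖ ≤ 6(S₀ + πS₁ + π²S₂)`; `C³` first moment `≤ 6R(πS₁ + π²S₂/R + π³S₃/R²)`, torus sup-norm form) are in the
  sequel `…SampledPeriodicSymbolKernelL1Deriv`.

Everything is proved; no definitions, no named facts; nothing about the Hubbard model.

References: S. Friedli, Y. Velenik, *Statistical Mechanics of Lattice Systems*, CUP 2017, §10.4 (discrete Fourier analysis on the torus)
(`FriedliVelenik2017`); the Bernstein embedding `H^s ↪ A(𝕋²)` is classical (Katznelson, *Harmonic Analysis*, Ch. I §6).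
-/

noncomputable section

namespace Summit.HubbardSuperconductivity.HubbardSuperconductivity.Theorems.SampledSymbolKernel

set_option linter.dupNamespace false -- summit = problem name (single-conjunct summit), D-0017

open Finset Literature.Probability.LatticeModels Literature.MathematicalPhysics.QuantumLattice
open scoped ComplexConjugate

/-! ### §1 `torusFourierInv` versus `torusFourier` -/

section Inv

variable {d L : ℕ} [NeZero L]

/-- `torusFourierInv g x = L⁻ᵈ·(torusFourier g)(−x)`. -/
theorem torusFourierInv_eq_torusFourier_neg (g : TorusSite d L → ℂ) (x : TorusSite d L) :
    torusFourierInv g x = ((L : ℂ) ^ d)⁻¹ * torusFourier g (-x) := by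
  rw [torusFourierInv_eq_sum_torusChar, torusFourier_eq_sum_torusChar]
  congr 1
  refine sum_congr rfl fun k _ => ?_
  rw [torusChar_comm (-x) k, torusChar_neg_right, Complex.conj_conj]

/-- `‖torusFourierInv g x‖ = L⁻ᵈ·‖(torusFourier g)(−x)‖`. -/
theorem norm_torusFourierInv_eq (g : TorusSite d L → ℂ) (x : TorusSite d L) :
    ‖torusFourierInv g x‖ = ((L : ℝ) ^ d)⁻¹ * ‖torusFourier g (-x)‖ := by
  rw [torusFourierInv_eq_torusFourier_neg, norm_mul, norm_inv, norm_pow, Complex.norm_natCast]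

/-- **`Σ_x ‖torusFourierInv g x‖ = L⁻ᵈ Σ_z ‖ĝ(z)‖`.** -/
theorem sum_norm_torusFourierInv_eq (g : TorusSite d L → ℂ) :
    ∑ x, ‖torusFourierInv g x‖ = ((L : ℝ) ^ d)⁻¹ * ∑ z, ‖torusFourier g z‖ := by
  simp_rw [norm_torusFourierInv_eq]
  rw [← mul_sum]
  congr 1
  exact Fintype.sum_equiv (Equiv.neg _) _ _ fun x => by simp

/-- The weighted form: `Σ_x |x̃_j|·‖torusFourierInv g x‖ = L⁻ᵈ Σ_z |z̃_j|·‖ĝ(z)‖` (`|(−x)~_j| = |x̃_j|`). -/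
theorem sum_abs_valMinAbs_mul_norm_torusFourierInv_eq (g : TorusSite d L → ℂ) (j : Fin d) :
    ∑ x, |((x j).valMinAbs : ℝ)| * ‖torusFourierInv g x‖ =
      ((L : ℝ) ^ d)⁻¹ * ∑ z, |((z j).valMinAbs : ℝ)| * ‖torusFourier g z‖ := by
  simp_rw [norm_torusFourierInv_eq]
  have h : ∀ x : TorusSite d L, |((x j).valMinAbs : ℝ)| * (((L : ℝ) ^ d)⁻¹ * ‖torusFourier g (-x)‖) =
      ((L : ℝ) ^ d)⁻¹ * (|(((-x) j).valMinAbs : ℝ)| * ‖torusFourier g (-x)‖) := by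
    intro x
    have habs : |((x j).valMinAbs : ℝ)| = |(((-x) j).valMinAbs : ℝ)| := by
      rw [Pi.neg_apply, ← Int.cast_abs, ← Int.cast_abs, Int.abs_eq_natAbs, Int.abs_eq_natAbs, ZMod.natAbs_valMinAbs_neg]
    rw [habs]; ring
  simp_rw [h]
  rw [← mul_sum]
  congr 1
  exact Fintype.sum_equiv (Equiv.neg _) _ _ fun x => by simp

end Inv

/-! ### §2 Mean-value bounds for vector-valued maps: first, mixed second and mixed third differences -/

section MeanValue

variable {V : Type*} [NormedAddCommGroup V] [NormedSpace ℝ V] {E : Type*} [NormedAddCommGroup E] [NormedSpace ℝ E]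

/-- First differences: `‖F(a) − F(b)‖ ≤ S₁‖a − b‖` when `‖DF‖ ≤ S₁`. -/
theorem norm_sub_le_of_norm_iteratedFDeriv_one {F : V → E} (hF : ContDiff ℝ 1 F) {S₁ : ℝ}
    (hS₁ : ∀ q, ‖iteratedFDeriv ℝ 1 F q‖ ≤ S₁) (a b : V) : ‖F a - F b‖ ≤ S₁ * ‖a - b‖ := by
  have hd : ∀ x ∈ (Set.univ : Set V), DifferentiableAt ℝ F x := fun x _ => hF.differentiable (by norm_num) x
  have hb : ∀ x ∈ (Set.univ : Set V), ‖fderiv ℝ F x‖ ≤ S₁ := fun x _ => by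
    rw [← norm_iteratedFDeriv_one]; exact hS₁ x
  exact Convex.norm_image_sub_le_of_norm_fderiv_le hd hb convex_univ (Set.mem_univ b) (Set.mem_univ a)

/-- The derivative is `S₂`-Lipschitz when `‖D²F‖ ≤ S₂`. -/
theorem norm_fderiv_sub_fderiv_le_of_norm_iteratedFDeriv_two {F : V → E} (hF : ContDiff ℝ 2 F) {S₂ : ℝ}
    (hS₂ : ∀ q, ‖iteratedFDeriv ℝ 2 F q‖ ≤ S₂) (p q : V) : ‖fderiv ℝ F p - fderiv ℝ F q‖ ≤ S₂ * ‖p - q‖ := by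
  have h1 : ContDiff ℝ 1 (fderiv ℝ F) := hF.fderiv_right (m := 1) (by norm_num)
  have hd : ∀ x ∈ (Set.univ : Set V), DifferentiableAt ℝ (fderiv ℝ F) x := fun x _ => h1.differentiable (by norm_num) x
  have hb : ∀ x ∈ (Set.univ : Set V), ‖fderiv ℝ (fderiv ℝ F) x‖ ≤ S₂ := fun x _ => by
    have h := hS₂ x
    rw [← norm_iteratedFDeriv_fderiv, norm_iteratedFDeriv_one] at h
    exact h
  exact Convex.norm_image_sub_le_of_norm_fderiv_le hd hb convex_univ (Set.mem_univ q) (Set.mem_univ p)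

/-- Mixed second differences: `‖F(a+v+w) − F(a+v) − F(a+w) + F(a)‖ ≤ S₂‖v‖‖w‖` when `‖D²F‖ ≤ S₂`. -/
theorem norm_second_diff_le_of_norm_iteratedFDeriv_two {F : V → E} (hF : ContDiff ℝ 2 F) {S₂ : ℝ}
    (hS₂ : ∀ q, ‖iteratedFDeriv ℝ 2 F q‖ ≤ S₂) (a v w : V) :
    ‖F (a + v + w) - F (a + v) - F (a + w) + F a‖ ≤ S₂ * ‖v‖ * ‖w‖ := by
  set φ : V → E := fun x => F (x + w) - F x with hφ
  have hFd : Differentiable ℝ F := hF.differentiable (by norm_num)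
  have hd : ∀ x ∈ (Set.univ : Set V), DifferentiableAt ℝ φ x := fun x _ =>
    ((differentiableAt_comp_add_right w).2 (hFd (x + w))).sub (hFd x)
  have hb : ∀ x ∈ (Set.univ : Set V), ‖fderiv ℝ φ x‖ ≤ S₂ * ‖w‖ := by
    intro x _
    have h1 : fderiv ℝ φ x = fderiv ℝ F (x + w) - fderiv ℝ F x := by
      rw [hφ, fderiv_fun_sub ((differentiableAt_comp_add_right w).2 (hFd (x + w))) (hFd x), fderiv_comp_add_right]
    rw [h1]
    have h := norm_fderiv_sub_fderiv_le_of_norm_iteratedFDeriv_two hF hS₂ (x + w) x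
    rwa [add_sub_cancel_left] at h
  have h := Convex.norm_image_sub_le_of_norm_fderiv_le hd hb convex_univ (Set.mem_univ a) (Set.mem_univ (a + v))
  rw [add_sub_cancel_left, hφ] at h
  dsimp only at h
  calc ‖F (a + v + w) - F (a + v) - F (a + w) + F a‖ = ‖F (a + v + w) - F (a + v) - (F (a + w) - F a)‖ := by abel_nf
    _ ≤ S₂ * ‖w‖ * ‖v‖ := h
    _ = S₂ * ‖v‖ * ‖w‖ := by ring

/-- `D²F` is `S₃`-Lipschitz when `‖D³F‖ ≤ S₃`. -/
theorem norm_iteratedFDeriv_two_sub_le_of_norm_iteratedFDeriv_three {F : V → E} (hF : ContDiff ℝ 3 F) {S₃ : ℝ}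
    (hS₃ : ∀ q, ‖iteratedFDeriv ℝ 3 F q‖ ≤ S₃) (x w : V) :
    ‖iteratedFDeriv ℝ 2 F (x + w) - iteratedFDeriv ℝ 2 F x‖ ≤ S₃ * ‖w‖ := by
  have hd : Differentiable ℝ (fun y => iteratedFDeriv ℝ 2 F y) := hF.differentiable_iteratedFDeriv (by norm_num)
  have hb : ∀ y ∈ (Set.univ : Set V), ‖fderiv ℝ (fun y => iteratedFDeriv ℝ 2 F y) y‖ ≤ S₃ := fun y _ => by
    rw [show (fun y => iteratedFDeriv ℝ 2 F y) = iteratedFDeriv ℝ 2 F from rfl, norm_fderiv_iteratedFDeriv]; exact hS₃ y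
  have h := Convex.norm_image_sub_le_of_norm_fderiv_le (fun y _ => hd y) hb convex_univ (Set.mem_univ x) (Set.mem_univ (x + w))
  rwa [add_sub_cancel_left] at h

/-- Mixed third differences: `‖Δ_w Δ_v Δ_u F(a)‖ ≤ S₃‖u‖‖v‖‖w‖` when `‖D³F‖ ≤ S₃`. -/
theorem norm_third_diff_le_of_norm_iteratedFDeriv_three {F : V → E} (hF : ContDiff ℝ 3 F) {S₃ : ℝ}
    (hS₃ : ∀ q, ‖iteratedFDeriv ℝ 3 F q‖ ≤ S₃) (a u v w : V) :
    ‖(F (a + u + v + w) - F (a + u + w) - F (a + v + w) + F (a + w)) - (F (a + u + v) - F (a + u) - F (a + v) + F a)‖ ≤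
      S₃ * ‖u‖ * ‖v‖ * ‖w‖ := by
  set φ : V → E := fun x => F (x + w) - F x with hφ
  have hF2 : ContDiff ℝ 2 F := hF.of_le (by norm_num)
  have hφ2 : ContDiff ℝ 2 φ := (hF2.comp (contDiff_id.add contDiff_const)).sub hF2
  have hφb : ∀ q, ‖iteratedFDeriv ℝ 2 φ q‖ ≤ S₃ * ‖w‖ := by
    intro q
    have hsub : iteratedFDeriv ℝ 2 φ q = iteratedFDeriv ℝ 2 (fun x => F (x + w)) q - iteratedFDeriv ℝ 2 F q := by
      rw [hφ, show (fun x => F (x + w) - F x) = (fun x => F (x + w)) - F from rfl]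
      exact iteratedFDeriv_sub_apply ((hF2.comp (contDiff_id.add contDiff_const)).contDiffAt) hF2.contDiffAt
    rw [hsub, iteratedFDeriv_comp_add_right]
    exact norm_iteratedFDeriv_two_sub_le_of_norm_iteratedFDeriv_three hF hS₃ q w
  have h := norm_second_diff_le_of_norm_iteratedFDeriv_two hφ2 hφb a u v
  have hre : φ (a + u + v) - φ (a + u) - φ (a + v) + φ a =
      (F (a + u + v + w) - F (a + u + w) - F (a + v + w) + F (a + w)) - (F (a + u + v) - F (a + u) - F (a + v) + F a) := by
    simp only [hφ]; abel
  rw [hre] at h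
  calc _ ≤ S₃ * ‖w‖ * ‖u‖ * ‖v‖ := h
    _ = S₃ * ‖u‖ * ‖v‖ * ‖w‖ := by ring

end MeanValue

/-! ### §3 Sampled periodic symbols: the difference form -/

section Sampled

variable {L : ℕ} [NeZero L]

/-- The sampling point of a torus momentum in `Momentum = ℝ²` (Euclidean): `P k⃗ = toLp 2 (p_{k⃗})`. -/
theorem toLp_latticeMomentum_add_single (k : TorusSite 2 L) (j : Fin 2) :
    ∃ z : Fin 2 → ℤ, (WithLp.toLp 2 (latticeMomentum L (k + Pi.single j 1)) : EuclideanSpace ℝ (Fin 2)) =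
      WithLp.toLp 2 (latticeMomentum L k) + WithLp.toLp 2 ((2 * Real.pi / L) • (Pi.single j (1 : ℝ) : Fin 2 → ℝ)) +
        WithLp.toLp 2 (fun i => (z i : ℝ) * (2 * Real.pi)) := by
  obtain ⟨z, hz⟩ := latticeMomentum_add_smul_single_eq k j 1
  refine ⟨z, ?_⟩
  rw [one_smul] at hz
  rw [hz, ← WithLp.toLp_add, ← WithLp.toLp_add]
  congr 1
  funext i
  simp only [Pi.add_apply, Nat.cast_one, one_mul]

variable (F : EuclideanSpace ℝ (Fin 2) → ℂ)
  (hper : ∀ (q : EuclideanSpace ℝ (Fin 2)) (z : Fin 2 → ℤ), F (q + WithLp.toLp 2 (fun i => (z i : ℝ) * (2 * Real.pi))) = F q)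
include hper

/-- **A unit lattice shift is a continuum shift by `2π/L`** for a periodic symbol, uniformly in what is added afterwards:
`F(P(k⃗ + e_j) + w) = F(P k⃗ + (2π/L)e_j + w)`. -/
theorem apply_toLp_latticeMomentum_add_single (k : TorusSite 2 L) (j : Fin 2) (w : EuclideanSpace ℝ (Fin 2)) :
    F (WithLp.toLp 2 (latticeMomentum L (k + Pi.single j 1)) + w) =
      F (WithLp.toLp 2 (latticeMomentum L k) + WithLp.toLp 2 ((2 * Real.pi / L) • (Pi.single j (1 : ℝ) : Fin 2 → ℝ)) + w) := by
  obtain ⟨z, hz⟩ := toLp_latticeMomentum_add_single k j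
  rw [hz, add_right_comm _ (WithLp.toLp 2 (fun i => (z i : ℝ) * (2 * Real.pi))) w, hper]

/-- **`ℓ¹` bound, difference form**: for a `(2πℤ)²`-periodic symbol with `‖F‖ ≤ S₀`, first differences at step `2π/L` along `e₀, e₁`
bounded by `D₁` and the mixed second difference by `D₂` (everywhere), the lattice position kernel `torusFourierInv (F ∘ P)` satisfies
`Σ_z ‖torusFourierInv (F ∘ P) z‖ ≤ 6·√(S₀² + L²D₁²/8 + L⁴D₂²/256)`. -/
theorem sum_norm_torusFourierInv_sampled_le_of_differences {S₀ D₁ D₂ : ℝ} (h0 : ∀ q, ‖F q‖ ≤ S₀)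
    (h1 : ∀ (q : EuclideanSpace ℝ (Fin 2)) (j : Fin 2),
      ‖F (q + WithLp.toLp 2 ((2 * Real.pi / L) • (Pi.single j (1 : ℝ) : Fin 2 → ℝ))) - F q‖ ≤ D₁)
    (h2 : ∀ q : EuclideanSpace ℝ (Fin 2),
      ‖F (q + WithLp.toLp 2 ((2 * Real.pi / L) • (Pi.single 0 (1 : ℝ) : Fin 2 → ℝ)) +
          WithLp.toLp 2 ((2 * Real.pi / L) • (Pi.single 1 (1 : ℝ) : Fin 2 → ℝ))) -
        F (q + WithLp.toLp 2 ((2 * Real.pi / L) • (Pi.single 0 (1 : ℝ) : Fin 2 → ℝ))) -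
        F (q + WithLp.toLp 2 ((2 * Real.pi / L) • (Pi.single 1 (1 : ℝ) : Fin 2 → ℝ))) + F q‖ ≤ D₂) :
    ∑ z : TorusSite 2 L, ‖torusFourierInv (fun k => F (WithLp.toLp 2 (latticeMomentum L k))) z‖ ≤
      6 * Real.sqrt (S₀ ^ 2 + (L : ℝ) ^ 2 / 8 * D₁ ^ 2 + (L : ℝ) ^ 4 / 256 * D₂ ^ 2) := by
  set g : TorusSite 2 L → ℂ := fun k => F (WithLp.toLp 2 (latticeMomentum L k)) with hg
  set v : Fin 2 → EuclideanSpace ℝ (Fin 2) := fun j => WithLp.toLp 2 ((2 * Real.pi / L) • (Pi.single j (1 : ℝ) : Fin 2 → ℝ)) with hv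
  have hs1 : ∀ (k : TorusSite 2 L) (j : Fin 2), g (k + Pi.single j 1) = F (WithLp.toLp 2 (latticeMomentum L k) + v j) := by
    intro k j
    have h := apply_toLp_latticeMomentum_add_single F hper k j 0
    rwa [add_zero, add_zero] at h
  have hs2 : ∀ (k : TorusSite 2 L) (j i : Fin 2),
      g (k + Pi.single j 1 + Pi.single i 1) = F (WithLp.toLp 2 (latticeMomentum L k) + v j + v i) := by
    intro k j i
    have h := apply_toLp_latticeMomentum_add_single F hper (k + Pi.single j 1) i 0
    rw [add_zero, add_zero] at h
    rw [hg]; dsimp only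
    rw [h, apply_toLp_latticeMomentum_add_single F hper k j (v i)]
  rw [sum_norm_torusFourierInv_eq]
  refine sum_norm_torusFourier_le_of_differences g (fun k => h0 _) (fun j k => ?_) (fun k => ?_)
  · rw [hs1]; exact h1 _ j
  · rw [hs2, hs1, hs1]; exact h2 _

/-- **First-moment bound, difference form** (direction `j`, integer scale `R ≥ 1`): with first / mixed-second / mixed-third differences at
step `2π/L` bounded by `D₁, D₂, D₃`, `Σ_z |z̃_j|·‖torusFourierInv (F ∘ P) z‖ ≤ 6R·√(L²D₁²/16 + L⁴D₂²/(128R²) + L⁶D₃²/(4096R⁴))`. -/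
theorem sum_abs_valMinAbs_mul_norm_torusFourierInv_sampled_le_of_differences (j : Fin 2) {R : ℕ} (hR : 1 ≤ R)
    {D₁ D₂ D₃ : ℝ}
    (h1 : ∀ q : EuclideanSpace ℝ (Fin 2), ‖F (q + WithLp.toLp 2 ((2 * Real.pi / L) • (Pi.single j (1 : ℝ) : Fin 2 → ℝ))) - F q‖ ≤ D₁)
    (h2 : ∀ (q : EuclideanSpace ℝ (Fin 2)) (i : Fin 2),
      ‖F (q + WithLp.toLp 2 ((2 * Real.pi / L) • (Pi.single j (1 : ℝ) : Fin 2 → ℝ)) +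
          WithLp.toLp 2 ((2 * Real.pi / L) • (Pi.single i (1 : ℝ) : Fin 2 → ℝ))) -
        F (q + WithLp.toLp 2 ((2 * Real.pi / L) • (Pi.single j (1 : ℝ) : Fin 2 → ℝ))) -
        F (q + WithLp.toLp 2 ((2 * Real.pi / L) • (Pi.single i (1 : ℝ) : Fin 2 → ℝ))) + F q‖ ≤ D₂)
    (h3 : ∀ q : EuclideanSpace ℝ (Fin 2),
      ‖(F (q + WithLp.toLp 2 ((2 * Real.pi / L) • (Pi.single j (1 : ℝ) : Fin 2 → ℝ)) +
            WithLp.toLp 2 ((2 * Real.pi / L) • (Pi.single 0 (1 : ℝ) : Fin 2 → ℝ)) +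
            WithLp.toLp 2 ((2 * Real.pi / L) • (Pi.single 1 (1 : ℝ) : Fin 2 → ℝ))) -
          F (q + WithLp.toLp 2 ((2 * Real.pi / L) • (Pi.single j (1 : ℝ) : Fin 2 → ℝ)) +
            WithLp.toLp 2 ((2 * Real.pi / L) • (Pi.single 1 (1 : ℝ) : Fin 2 → ℝ))) -
          F (q + WithLp.toLp 2 ((2 * Real.pi / L) • (Pi.single 0 (1 : ℝ) : Fin 2 → ℝ)) +
            WithLp.toLp 2 ((2 * Real.pi / L) • (Pi.single 1 (1 : ℝ) : Fin 2 → ℝ))) +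
          F (q + WithLp.toLp 2 ((2 * Real.pi / L) • (Pi.single 1 (1 : ℝ) : Fin 2 → ℝ)))) -
        (F (q + WithLp.toLp 2 ((2 * Real.pi / L) • (Pi.single j (1 : ℝ) : Fin 2 → ℝ)) +
            WithLp.toLp 2 ((2 * Real.pi / L) • (Pi.single 0 (1 : ℝ) : Fin 2 → ℝ))) -
          F (q + WithLp.toLp 2 ((2 * Real.pi / L) • (Pi.single j (1 : ℝ) : Fin 2 → ℝ))) -
          F (q + WithLp.toLp 2 ((2 * Real.pi / L) • (Pi.single 0 (1 : ℝ) : Fin 2 → ℝ))) + F q)‖ ≤ D₃) :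
    ∑ z : TorusSite 2 L, |((z j).valMinAbs : ℝ)| * ‖torusFourierInv (fun k => F (WithLp.toLp 2 (latticeMomentum L k))) z‖ ≤
      6 * (R : ℝ) * Real.sqrt ((L : ℝ) ^ 2 / 16 * D₁ ^ 2 + (L : ℝ) ^ 4 / (128 * (R : ℝ) ^ 2) * D₂ ^ 2 +
        (L : ℝ) ^ 6 / (4096 * (R : ℝ) ^ 4) * D₃ ^ 2) := by
  set g : TorusSite 2 L → ℂ := fun k => F (WithLp.toLp 2 (latticeMomentum L k)) with hg
  set v : Fin 2 → EuclideanSpace ℝ (Fin 2) := fun j => WithLp.toLp 2 ((2 * Real.pi / L) • (Pi.single j (1 : ℝ) : Fin 2 → ℝ)) with hv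
  have hsh : ∀ (k : TorusSite 2 L) (i : Fin 2) (w : EuclideanSpace ℝ (Fin 2)),
      F (WithLp.toLp 2 (latticeMomentum L (k + Pi.single i 1)) + w) = F (WithLp.toLp 2 (latticeMomentum L k) + v i + w) :=
    fun k i w => apply_toLp_latticeMomentum_add_single F hper k i w
  have hs1 : ∀ (k : TorusSite 2 L) (i : Fin 2), g (k + Pi.single i 1) = F (WithLp.toLp 2 (latticeMomentum L k) + v i) := by
    intro k i
    have h := hsh k i 0
    rwa [add_zero, add_zero] at h
  have hs2 : ∀ (k : TorusSite 2 L) (i i' : Fin 2),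
      g (k + Pi.single i 1 + Pi.single i' 1) = F (WithLp.toLp 2 (latticeMomentum L k) + v i + v i') := by
    intro k i i'
    rw [hg]; dsimp only
    rw [← add_zero (WithLp.toLp 2 (latticeMomentum L (k + Pi.single i 1 + Pi.single i' 1))), hsh, add_zero, hsh]
  have hs3 : ∀ (k : TorusSite 2 L) (i i' i'' : Fin 2),
      g (k + Pi.single i 1 + Pi.single i' 1 + Pi.single i'' 1) = F (WithLp.toLp 2 (latticeMomentum L k) + v i + v i' + v i'') := by
    intro k i i' i''
    rw [hg]; dsimp only
    rw [← add_zero (WithLp.toLp 2 (latticeMomentum L (k + Pi.single i 1 + Pi.single i' 1 + Pi.single i'' 1))), hsh, add_zero,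
      hsh, add_assoc, hsh, ← add_assoc]
  rw [sum_abs_valMinAbs_mul_norm_torusFourierInv_eq]
  refine sum_abs_valMinAbs_mul_norm_torusFourier_le g j hR (fun k => ?_) (fun i k => ?_) (fun k => ?_)
  · rw [hs1]; exact h1 _
  · rw [hs2, hs1, hs1]; exact h2 _ i
  · rw [hs3, hs2, hs2, hs1, hs2, hs1, hs1]; exact h3 _

end Sampled

end Summit.HubbardSuperconductivity.HubbardSuperconductivity.Theorems.SampledSymbolKernel

end
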